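import Summits.QuantumFields.BalabanUV.Beta.EriceRemainderEnclosureHistoryAutonomyComparisonAgeCompositionEnteringLagLevels

/-!
# EriceRemainderEnclosureHistoryAutonomyComparisonAgeCompositionEnteringLagLevelsEdge — (E87a) route (N), first order: THE STATIC FAMILY (S-h) SHARPENED
# AT THE EDGE — (E86c) `old_read_antitone_of_decay_defect` with the truncation indicator ALSO on its left side (the family (S-h♭)): the young drops read
# by the entering lag vanish beyond the edge `j`, lag by lag, for free

Cell `pub-balaban`, β-function sub-cell, BINDER row D4 «RemainderConst leaves for Bałaban's split» (`HOME/BINDER-OWNERS.md`; owner lineage `b2b-balaban-beta-an4`;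
this file by co-owner #2 lineage `b2b-balaban-beta-d4-p2`, generation 78), β-FLOW TEAM duty (1), FREEZE (0) honoured (def-free; imports (E86c); uses (E86c)
`mono_chain` ∕ `sol_support` ∕ `sol_lower`, (E83a) `read_succ_onelag`, (E83i) `growth_chain`, (E71a) `sol_nonneg_le_of_supersol` ∕ `read_nonneg` BY NAME;
nothing restated; (E86c) itself is NOT modified).

HONEST FRAMING (page 1, verbatim and binding).  *"Discharging BetaPertH makes Bałaban's UV stability UNCONDITIONAL — a real constructive-QFT result; it is
NOT the continuum limit and NOT the Clay problem."*  THIS FILE DISCHARGES NOTHING OF THE KIND.  Elementary real analysis about ABSTRACT non-negative window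
kernels and the FIRST-ORDER renewal objects of route (N); the objects it will serve are built on the cell's own NOT-IN-PRINT binders (the age profile of
Bałaban's (1.22) limit functional is NOT PRINTED — [I] p. 298; GAPS G-t4-U2-1∕-2) and NOT asserted.  Row D4 class UNCHANGED (critical-path width 0; instance
0∕1; D4 DISCHARGE NO DATE).  HONEST DEPENDENCY: continuum YM on T⁴ ⇐ BetaPertH ∧ nine spine estimates (0/9 proved); BetaPertH ⇐ (D1) ∧ (D4) ∧ CAP+tail;
G-an2-4 gates asym, D1 and NE2/3/4.

THE POINT (census sense (α); route (N); README `HOME/b2b-balaban-beta-d4-p2/g78/e87/README.md`).  (E86c)'s (S-h) asks, at every pin `n` with `n+1+yo ≤ j`,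
`Ko (n+1)(yo−1)·Σ_{l<y} Ky (n+1+yo) l·Π_{s∈[n+2,n+2+yo+l)} H_s ≤ (1−σo_n)·Σ_{l'} Ko n l'·A_j(n+1+l') + σo_n·Ko n 0·A_j(n+1)` — the young LOWER masses `A_j`
on the right carry the truncation indicator `[p+1+l ≤ j]`, the young row on the left does not.  But the left side bounds the young drop
`d(n+1+yo) = Σ_l Ky (n+1+yo) l·t(n+2+yo+l)` and the young solution `t` VANISHES beyond `j` ((E86c) `sol_support`): the lag `l` contributes only when
`n+2+yo+l ≤ j`.  §1 **`old_read_antitone_of_decay_defect_edge`**: (E86c)'s conclusion (the old reads of the young drops non-increasing in the pin) from the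
SHARPENED family **(S-h♭)**: the same inequality with the summand on the left multiplied by `[n+2+yo+l ≤ j]`.  WHY IT MATTERS (generation-78 census,
`g78/numerics/sh1.py`, benchmark three-age flows `{1,k₂,k₃}`, 8 load regimes, classes one∕self∕lower∕adversarial-relaxed, pins `m ≤ k₃`): the generation-77
census evaluated (S-h) in its `j = ∞` form (log-ratio `−0.27 … −0.57`, never violated); AS TYPED, the worst truncation is the edge `j = m+1+k₃`, where the right
side keeps only the lags `l ≤ k₃−1−l'` and the log-ratio degrades with `k₃`: `−0.33` (8), `−0.16` (16), `−0.03` (32), **`+0.035` (48), `+0.068` (64)** (class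
lower; `+0.014` at 64 in the SELF-CONSISTENT class) — violated on benign flows (long light middle window `k₂ = k₃−1` under a saturated old age, pin 0), hence
NOT dischargeable along flows.  With the indicator on the left the worst truncation is `j = m+1+k₃+k₂` (left side complete), where every `A_j` on the right
is complete too: (S-h♭) at its worst edge IS the `j = ∞` form of the census (`−0.27 … −0.57`, `k₃ ≤ 64`; never violated adversarially, g77 j334152∕j334919).
NOT CLAIMED: (S-h♭) along flows (its reduction needs COUPLED dampings — README §3); anything nonlinear; anything printed — NOT B12 Thm 2, NOT BetaPertH.

WHAT IS PROVED ([folklore]; 0 `def`, 0 sorry).  §1 **`old_read_antitone_of_decay_defect_edge`**.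
-/
noncomputable section
open Finset

namespace Summit.QuantumFields.BalabanUV.Beta.EriceRemainderEnclosureHistoryAutonomyComparisonAgeCompositionEnteringLagLevelsEdge

open Summit.QuantumFields.BalabanUV.Beta.EriceRemainderEnclosureHistoryAutonomyComparisonAgeComposition
open Summit.QuantumFields.BalabanUV.Beta.EriceRemainderEnclosureHistoryAutonomyComparisonAgeCompositionEnteringLag (read_succ_onelag)
open Summit.QuantumFields.BalabanUV.Beta.EriceRemainderEnclosureHistoryAutonomyComparisonAgeCompositionDecayRoute (growth_chain)
open Summit.QuantumFields.BalabanUV.Beta.EriceRemainderEnclosureHistoryAutonomyComparisonAgeCompositionEnteringLagLevels (mono_chain sol_support sol_lower)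

variable {N y : ℕ}

/-! ## §1 (S-h♭): the truncation indicator on the left -/

/-- **(MONO) FOR A PAIR OF MULTI-LAG AGES FROM DECAY AND DEFECT — THE FAMILY SHARPENED AT THE EDGE, (S-h♭).**  Setting of (E86c)
`old_read_antitone_of_decay_defect` verbatim (young kernel `Ky ≥ 0` with `y ≥ 1` lags, input `v ≥ 0` supported on `[0,j]` and non-decreasing below the
edge, growth `H ≥ 0`, KEY ratio `ρ ≤ 1`, young solution `t`, young lower masses `A p = Σ_{l<y} [p+1+l ≤ j]·Ky p l·(1−ρ(p+1+l))`; old window kernel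
`Ko ≥ 0` with `yo ≥ 1` lags and the one-lag structure `σo ∈ [0,1]`).  IF **(S-h♭)** holds at the pins `n+1+yo ≤ j`:
`Ko (n+1)(yo−1)·Σ_{l<y} [n+2+yo+l ≤ j]·Ky (n+1+yo) l·Π_{s∈[n+2,n+2+yo+l)} H_s ≤ (1−σo_n)·Σ_{l'<yo} Ko n l'·A(n+1+l') + σo_n·Ko n 0·A(n+1)`,
THEN `Ro (Ry t) (n+1) ≤ Ro (Ry t) n` at every pin.  The only change to (E86c)'s proof: the young drop read by the entering lag is
`d(n+1+yo) = Σ_l Ky (n+1+yo) l·t(n+2+yo+l)` and `t = 0` beyond `j` (`sol_support`), so its static upper bound keeps the indicator. [folklore] -/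
theorem old_read_antitone_of_decay_defect_edge
    {Ky : ℕ → ℕ → ℝ} {Ry : (ℕ → ℝ) → ℕ → ℝ}
    (hRy : ∀ v n, Ry v n = ∑ l ∈ range N, Ky n l * v (n + 1 + l)) (hKy : ∀ n l, 0 ≤ Ky n l) (hKyy : ∀ n l, y ≤ l → Ky n l = 0) (hyN : y ≤ N)
    {yo : ℕ} {Ko : ℕ → ℕ → ℝ} {Ro : (ℕ → ℝ) → ℕ → ℝ} {σo : ℕ → ℝ}
    (hRo : ∀ v n, Ro v n = ∑ l ∈ range N, Ko n l * v (n + 1 + l)) (hKo : ∀ n l, 0 ≤ Ko n l) (hKoy : ∀ n l, yo ≤ l → Ko n l = 0)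
    (hyo : 1 ≤ yo) (hyoN : yo ≤ N)
    (hσo : ∀ n l, l + 1 < yo → Ko (n + 1) l = σo n * Ko n (l + 1)) (hσo01 : ∀ n, 0 ≤ σo n ∧ σo n ≤ 1)
    {v : ℕ → ℝ} {j : ℕ} (hv0 : ∀ n, 0 ≤ v n) (hvj : ∀ n, j < n → v n = 0) (hmono : ∀ m, m < j → v m ≤ v (m + 1))
    {H : ℕ → ℝ} (hH0 : ∀ p, 0 ≤ H p) (hgrow : ∀ p, v (p + 1) ≤ H p * v p)
    {ρ : ℕ → ℝ} (hkey : ∀ n, Ry v n ≤ ρ n * v n) (hρ1 : ∀ n, ρ n ≤ 1)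
    {t : ℕ → ℝ} (htail : ∀ n, N < n → t n = 0) (hrec : ∀ n, t n = v n - Ry t n)
    {A : ℕ → ℝ} (hA : ∀ p, A p = ∑ l ∈ range y, if p + 1 + l ≤ j then Ky p l * (1 - ρ (p + 1 + l)) else 0)
    (hSh : ∀ n, n + 1 + yo ≤ j →
      Ko (n + 1) (yo - 1) * ∑ l ∈ range y, (if n + 2 + yo + l ≤ j then Ky (n + 1 + yo) l * ∏ s ∈ Ico (n + 2) (n + 2 + yo + l), H s else 0) ≤
        (1 - σo n) * ∑ l' ∈ range yo, Ko n l' * A (n + 1 + l') + σo n * (Ko n 0 * A (n + 1))) :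
    ∀ n, Ro (Ry t) (n + 1) ≤ Ro (Ry t) n := by
  have hsup : ∀ n, Ry v n ≤ v n := fun n => (hkey n).trans (by nlinarith [hρ1 n, hv0 n])
  have htv := sol_nonneg_le_of_supersol hRy hKy hv0 hsup htail hrec
  have ht0 := sol_support hvj htv
  have htlow := sol_lower hRy hKy hkey htv hrec
  -- the young drops: signs, support, the static sandwich
  set d : ℕ → ℝ := Ry t with hd
  have hd0 : ∀ p, 0 ≤ d p := fun p => read_nonneg hRy hKy fun m _ => (htv m).1
  have hdz : ∀ p, j < p + 1 → d p = 0 := fun p hp => by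
    rw [hd, hRy]; exact sum_eq_zero fun l _ => by rw [ht0 _ (by omega), mul_zero]
  have hA0 : ∀ p, 0 ≤ A p := fun p => by
    rw [hA]; exact sum_nonneg fun l _ => by split_ifs <;> nlinarith [hKy p l, hρ1 (p + 1 + l)]
  have hdlow : ∀ p, A p * v (p + 1) ≤ d p := by
    intro p
    rw [hA, hd, hRy, sum_mul]
    have hsub : ∑ l ∈ range y, Ky p l * t (p + 1 + l) ≤ ∑ l ∈ range N, Ky p l * t (p + 1 + l) :=
      sum_le_sum_of_subset_of_nonneg (range_subset_range.mpr hyN) fun l _ _ => mul_nonneg (hKy p l) (htv _).1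
    refine le_trans (sum_le_sum fun l hl => ?_) hsub
    split_ifs with hpl
    · have hv1 : v (p + 1) ≤ v (p + 1 + l) := mono_chain hmono l (p + 1) (by omega)
      have hρl : 0 ≤ 1 - ρ (p + 1 + l) := by linarith [hρ1 (p + 1 + l)]
      calc Ky p l * (1 - ρ (p + 1 + l)) * v (p + 1) ≤ Ky p l * ((1 - ρ (p + 1 + l)) * v (p + 1 + l)) := by
            rw [mul_assoc]; exact mul_le_mul_of_nonneg_left (mul_le_mul_of_nonneg_left hv1 hρl) (hKy p l)
        _ ≤ Ky p l * t (p + 1 + l) := mul_le_mul_of_nonneg_left (htlow _) (hKy p l)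
    · rw [zero_mul]; exact mul_nonneg (hKy p l) (htv _).1
  have hdup : ∀ n, d (n + 1 + yo) ≤
      (∑ l ∈ range y, (if n + 2 + yo + l ≤ j then Ky (n + 1 + yo) l * ∏ s ∈ Ico (n + 2) (n + 2 + yo + l), H s else 0)) * v (n + 2) := by
    intro n
    rw [hd, hRy, sum_mul]
    have heq : ∑ l ∈ range N, Ky (n + 1 + yo) l * t (n + 1 + yo + 1 + l) = ∑ l ∈ range y, Ky (n + 1 + yo) l * t (n + 1 + yo + 1 + l) :=
      (sum_subset (range_subset_range.mpr hyN) fun l _ hly => by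
        rw [hKyy _ l (by rw [mem_range, not_lt] at hly; exact hly), zero_mul]).symm
    rw [heq]
    refine sum_le_sum fun l _ => ?_
    split_ifs with hlj
    · have hg := growth_chain hH0 hgrow (n + 2) (yo + l)
      rw [show n + 2 + (yo + l) = n + 1 + yo + 1 + l by ring] at hg
      have hI : Ico (n + 2) (n + 1 + yo + 1 + l) = Ico (n + 2) (n + 2 + yo + l) := by rw [show n + 1 + yo + 1 + l = n + 2 + yo + l by ring]
      rw [hI] at hg
      calc Ky (n + 1 + yo) l * t (n + 1 + yo + 1 + l) ≤ Ky (n + 1 + yo) l * v (n + 1 + yo + 1 + l) := mul_le_mul_of_nonneg_left (htv _).2 (hKy _ _)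
        _ ≤ Ky (n + 1 + yo) l * ((∏ s ∈ Ico (n + 2) (n + 2 + yo + l), H s) * v (n + 2)) := mul_le_mul_of_nonneg_left hg (hKy _ _)
        _ = Ky (n + 1 + yo) l * (∏ s ∈ Ico (n + 2) (n + 2 + yo + l), H s) * v (n + 2) := by ring
    · -- beyond the edge the young solution vanishes
      rw [ht0 _ (by omega), mul_zero, zero_mul]
  -- the old kernel reading the young drops: identity, leaving term, criterion
  intro n
  have hid := read_succ_onelag hRo hKoy hyo hyoN hσo d n
  have hlead : Ko n 0 * d (n + 1) ≤ Ro d n := by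
    rw [hRo]
    have h := single_le_sum (f := fun l => Ko n l * d (n + 1 + l)) (fun l _ => mul_nonneg (hKo n l) (hd0 _)) (mem_range.mpr (by omega : 0 < N))
    simpa using h
  have hcrit : Ko (n + 1) (yo - 1) * d (n + 1 + yo) ≤ (1 - σo n) * Ro d n + σo n * (Ko n 0 * d (n + 1)) → Ro d (n + 1) ≤ Ro d n := by
    intro h
    have e1 : σo n * (Ro d n - Ko n 0 * d (n + 1)) = σo n * Ro d n - σo n * (Ko n 0 * d (n + 1)) := by ring
    have e2 : (1 - σo n) * Ro d n = Ro d n - σo n * Ro d n := by ring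
    rw [hid]; linarith
  by_cases hedge : j < n + 1 + yo
  · -- free: the young drops vanish beyond the edge
    refine hcrit ?_
    rw [hdz _ (by omega), mul_zero]
    have h1 : 0 ≤ (1 - σo n) * Ro d n := mul_nonneg (by linarith [(hσo01 n).2]) (by linarith [mul_nonneg (hKo n 0) (hd0 (n + 1))])
    have h2 : 0 ≤ σo n * (Ko n 0 * d (n + 1)) := mul_nonneg (hσo01 n).1 (mul_nonneg (hKo n 0) (hd0 _))
    linarith
  · have hnj : n + 1 + yo ≤ j := by omega
    refine hcrit ?_
    -- lower: every old lag reads a young drop at least `A · v`, and `v` there is at least `v (n+2)` (below the edge)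
    have hlow : (∑ l' ∈ range yo, Ko n l' * A (n + 1 + l')) * v (n + 2) ≤ Ro d n := by
      rw [hRo, sum_mul]
      have hsub : ∑ l ∈ range yo, Ko n l * d (n + 1 + l) ≤ ∑ l ∈ range N, Ko n l * d (n + 1 + l) :=
        sum_le_sum_of_subset_of_nonneg (range_subset_range.mpr hyoN) fun l _ _ => mul_nonneg (hKo n l) (hd0 _)
      refine le_trans (sum_le_sum fun l hl => ?_) hsub
      have hly := mem_range.mp hl
      have hv2 : v (n + 2) ≤ v (n + 1 + l + 1) := by
        have h := mono_chain hmono l (n + 2) (by omega); rwa [show n + 2 + l = n + 1 + l + 1 by ring] at h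
      calc Ko n l * A (n + 1 + l) * v (n + 2) ≤ Ko n l * (A (n + 1 + l) * v (n + 1 + l + 1)) := by
            rw [mul_assoc]; exact mul_le_mul_of_nonneg_left (mul_le_mul_of_nonneg_left hv2 (hA0 _)) (hKo n l)
        _ ≤ Ko n l * d (n + 1 + l) := mul_le_mul_of_nonneg_left (hdlow _) (hKo n l)
    have hlow0 : Ko n 0 * (A (n + 1) * v (n + 2)) ≤ Ko n 0 * d (n + 1) := by
      have h := hdlow (n + 1); rw [show n + 1 + 1 = n + 2 by ring] at h
      exact mul_le_mul_of_nonneg_left h (hKo n 0)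
    have h1 : Ko (n + 1) (yo - 1) * d (n + 1 + yo) ≤
        Ko (n + 1) (yo - 1) * ((∑ l ∈ range y, (if n + 2 + yo + l ≤ j then Ky (n + 1 + yo) l * ∏ s ∈ Ico (n + 2) (n + 2 + yo + l), H s else 0)) * v (n + 2)) :=
      mul_le_mul_of_nonneg_left (hdup n) (hKo _ _)
    have h2 : (1 - σo n) * ((∑ l' ∈ range yo, Ko n l' * A (n + 1 + l')) * v (n + 2)) ≤ (1 - σo n) * Ro d n :=
      mul_le_mul_of_nonneg_left hlow (by linarith [(hσo01 n).2])
    have h3 : σo n * (Ko n 0 * (A (n + 1) * v (n + 2))) ≤ σo n * (Ko n 0 * d (n + 1)) := mul_le_mul_of_nonneg_left hlow0 (hσo01 n).1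
    have h4 : (Ko (n + 1) (yo - 1) * ∑ l ∈ range y, (if n + 2 + yo + l ≤ j then Ky (n + 1 + yo) l * ∏ s ∈ Ico (n + 2) (n + 2 + yo + l), H s else 0)) * v (n + 2) ≤
        ((1 - σo n) * ∑ l' ∈ range yo, Ko n l' * A (n + 1 + l') + σo n * (Ko n 0 * A (n + 1))) * v (n + 2) :=
      mul_le_mul_of_nonneg_right (hSh n hnj) (hv0 _)
    have e1 : Ko (n + 1) (yo - 1) * ((∑ l ∈ range y, (if n + 2 + yo + l ≤ j then Ky (n + 1 + yo) l * ∏ s ∈ Ico (n + 2) (n + 2 + yo + l), H s else 0)) * v (n + 2)) =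
        (Ko (n + 1) (yo - 1) * ∑ l ∈ range y, (if n + 2 + yo + l ≤ j then Ky (n + 1 + yo) l * ∏ s ∈ Ico (n + 2) (n + 2 + yo + l), H s else 0)) * v (n + 2) := by ring
    have e2 : ((1 - σo n) * ∑ l' ∈ range yo, Ko n l' * A (n + 1 + l') + σo n * (Ko n 0 * A (n + 1))) * v (n + 2) =
        (1 - σo n) * ((∑ l' ∈ range yo, Ko n l' * A (n + 1 + l')) * v (n + 2)) + σo n * (Ko n 0 * (A (n + 1) * v (n + 2))) := by ring
    linarith


end Summit.QuantumFields.BalabanUV.Beta.EriceRemainderEnclosureHistoryAutonomyComparisonAgeCompositionEnteringLagLevelsEdge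

end
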